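import Mathlib
import HarnessLib
import Literature.AlgebraicGeometry.Resolution.AffineBlowupIntegral
import Summits.ResolutionOfSingularities.ResolutionOfSingularities.Theorems.WildQuotientsWildQuotientResolutionJordanFiveFrameDefs
import Summits.ResolutionOfSingularities.ResolutionOfSingularities.Theorems.WildQuotientsWildQuotientResolutionJordanFiveChartD
import Summits.ResolutionOfSingularities.ResolutionOfSingularities.Theorems.WildQuotientsWildQuotientResolutionInitialFormInjective
import Summits.ResolutionOfSingularities.ResolutionOfSingularities.Theorems.WildQuotientsWildQuotientResolutionAffineQuotientData
import Summits.ResolutionOfSingularities.ResolutionOfSingularities.Theorems.WildQuotientsWildQuotientResolutionJordanFourI6StableJ4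

/-!
# RUNG V5 frame (B1): `I₁₂ = {f : every monomial of f has (4,3,2,1)-weight ≥ 12}` is `⟨J₅⟩`-stable
(crux stmt-ResolutionOfSingularities-15640 `WildQuotients.WildQuotientResolution`, line `Sketch`;
chain w45c RUNG V5, res-L1-w45c-plan-1 RULING 2026-08-27T10:46:39Z «hJ / frame (B1) = lead-1»;
[OURS · L1 W4.5c] — NOT a statement of any manuscript. Lead prover res-L1-w45c-lead-1.)

`J₅` datum (`σ x_b = x_b + x_a`, `σ x_c = x_c + x_b`, `σ x_d = x_d + x_c`, …) and the centre
`I₁₂ = ⟨gens12⟩` of the `(4,3,2,1)`-weighted first floor (`…JordanFiveFrameDefs`, p523816):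
`weight_eq` (the weight of an exponent vector is `4 m_a + 3 m_b + 2 m_c + m_d`);
`exists_exps12_le` (dominance: every quadruple of weight `≥ 12` dominates a row of `exps12` —
reduction to a box decided by the kernel); **`mem_I12_iff`** (`f ∈ I₁₂ ↔` every monomial of `f`
has weight `≥ 12`; `JordanFour.lb_*` calculus p502667); `lb_aeval_of_lb_X` (weight-raising
substitutions preserve lower bounds) ⇒ **`map_I12_eq`**, `smul_I12_eq`, **`idealSheaf_I12_comap`**
= VERBATIM the hypothesis `hJ` of the scaffold `jordanFive_hasResolution_of_bricks` (p527978) and of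
`IsBlowup.liftAction`; `I12_blowup_integral_proper_birational` (`I₁₂ ∋ x_a³ ≠ 0`).
-/
-- single-problem summit: the doubled namespace component `ResolutionOfSingularities` is forced
set_option linter.dupNamespace false

noncomputable section

open MvPolynomial AlgebraicGeometry
open scoped Pointwise
open Literature.AlgebraicGeometry.Resolution

namespace Summit.ResolutionOfSingularities.ResolutionOfSingularities.Theorems.WildQuotientResolution.JordanFive

variable (k : Type) [Field k] (n : ℕ) (a b c d : Fin n)

/-! ## The weight `(4,3,2,1)` -/

/-- The weight function as a combination of indicator functions (needs `a, b, c, d` distinct).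
[folklore] -/
theorem weight_apply_eq (hab : a ≠ b) (hac : a ≠ c) (had : a ≠ d) (hbc : b ≠ c) (hbd : b ≠ d)
    (hcd : c ≠ d) (i : Fin n) :
    weight n a b c d i = 4 * Pi.single (M := fun _ => ℕ) a 1 i + 3 * Pi.single (M := fun _ => ℕ) b 1 i +
      2 * Pi.single (M := fun _ => ℕ) c 1 i + Pi.single (M := fun _ => ℕ) d 1 i := by
  simp only [Pi.single_apply]
  by_cases hia : i = a
  · subst hia; simp [weight, hab, hac, had]
  by_cases hib : i = b
  · subst hib; simp [weight, hia, hbc, hbd]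
  by_cases hic : i = c
  · subst hic; simp [weight, hia, hib, hcd]
  by_cases hid : i = d
  · subst hid; simp [weight, hia, hib, hic]
  · simp [weight, hia, hib, hic, hid]

/-- **The `(4,3,2,1)`-weight of an exponent vector is `4 m_a + 3 m_b + 2 m_c + m_d`.** [folklore] -/
theorem weight_eq (hab : a ≠ b) (hac : a ≠ c) (had : a ≠ d) (hbc : b ≠ c) (hbd : b ≠ d)
    (hcd : c ≠ d) (m : Fin n →₀ ℕ) :
    Finsupp.weight (weight n a b c d) m = 4 * m a + 3 * m b + 2 * m c + m d := by
  classical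
  rw [Finsupp.weight_apply, Finsupp.sum_fintype _ _ (fun i => by simp)]
  simp only [smul_eq_mul, weight_apply_eq n a b c d hab hac had hbc hbd hcd, mul_add,
    Finset.sum_add_distrib]
  simp only [Pi.single_apply, mul_ite, mul_one, mul_zero, Finset.sum_ite_eq', Finset.mem_univ,
    if_true]
  ring

/-! ## Dominance: every monomial of weight `≥ 12` is a multiple of a generator -/

/-- The box case of the dominance lemma, decided by the kernel. [OURS · L1 W4.5c] -/
theorem exists_exps12_le_box :
    ∀ x : Fin 3, ∀ y : Fin 4, ∀ z : Fin 6, ∀ w : Fin 12, 12 ≤ 4 * x.1 + 3 * y.1 + 2 * z.1 + w.1 →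
      ∃ j : Fin 40, (exps12 j).1 ≤ x.1 ∧ (exps12 j).2.1 ≤ y.1 ∧ (exps12 j).2.2.1 ≤ z.1 ∧
        (exps12 j).2.2.2 ≤ w.1 := by
  decide

/-- **Dominance**: every quadruple `(m_a, m_b, m_c, m_d)` of weight `4m_a + 3m_b + 2m_c + m_d ≥ 12`
dominates a row of `exps12` componentwise. [OURS · L1 W4.5c] -/
theorem exists_exps12_le (ma mb mc md : ℕ) (h : 12 ≤ 4 * ma + 3 * mb + 2 * mc + md) :
    ∃ j : Fin 40, (exps12 j).1 ≤ ma ∧ (exps12 j).2.1 ≤ mb ∧ (exps12 j).2.2.1 ≤ mc ∧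
      (exps12 j).2.2.2 ≤ md := by
  by_cases ha : 3 ≤ ma
  · exact ⟨0, by simp [exps12]; omega⟩
  by_cases hb : 4 ≤ mb
  · exact ⟨1, by simp [exps12]; omega⟩
  by_cases hc : 6 ≤ mc
  · exact ⟨2, by simp [exps12]; omega⟩
  by_cases hd : 12 ≤ md
  · exact ⟨3, by simp [exps12]; omega⟩
  exact exists_exps12_le_box ⟨ma, by omega⟩ ⟨mb, by omega⟩ ⟨mc, by omega⟩ ⟨md, by omega⟩ h

/-- The exponent vector of the generator `gens12 j` as a finitely supported function. [folklore] -/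
theorem gens12_eq_monomial_finsupp (j : Fin 40) :
    gens12 k n a b c d j = monomial ((exps12 j).1 • Finsupp.single a 1 +
      (exps12 j).2.1 • Finsupp.single b 1 + (exps12 j).2.2.1 • Finsupp.single c 1 +
      (exps12 j).2.2.2 • Finsupp.single d 1) 1 := by
  rw [gens12_eq_monomial, X_pow_eq_monomial, X_pow_eq_monomial, X_pow_eq_monomial,
    X_pow_eq_monomial, monomial_mul, monomial_mul, monomial_mul]
  simp only [mul_one, Finsupp.smul_single, smul_eq_mul]

-- `twelve_le_weight_exps12` (the generator exponents have weight `≥ 12`) is res-L1-w45c-stub-3's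
-- `…JordanFiveChartD` (p525059), imported.

/-! ## `I₁₂` = the polynomials all of whose monomials have weight `≥ 12` -/

/-- Evaluation of the generator exponent vector at the four block coordinates and elsewhere.
[folklore] -/
theorem exps_finsupp_apply (hab : a ≠ b) (hac : a ≠ c) (had : a ≠ d) (hbc : b ≠ c) (hbd : b ≠ d)
    (hcd : c ≠ d) (α β γ δ : ℕ) (i : Fin n) :
    (α • Finsupp.single a 1 + β • Finsupp.single b 1 + γ • Finsupp.single c 1 +
      δ • Finsupp.single d 1 : Fin n →₀ ℕ) i =
      α * Pi.single (M := fun _ => ℕ) a 1 i + β * Pi.single (M := fun _ => ℕ) b 1 i +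
      γ * Pi.single (M := fun _ => ℕ) c 1 i + δ * Pi.single (M := fun _ => ℕ) d 1 i := by
  simp only [Finsupp.coe_add, Finsupp.coe_smul, Pi.add_apply, Pi.smul_apply, smul_eq_mul,
    Finsupp.single_apply, Pi.single_apply]
  by_cases hia : i = a
  · subst hia; simp [hab.symm, hac.symm, had.symm, hab, hac, had]
  by_cases hib : i = b
  · subst hib; simp [hia, hbc, hbd, hbc.symm, hbd.symm, Ne.symm hia]
  by_cases hic : i = c
  · subst hic; simp [hia, hib, hcd, hcd.symm, Ne.symm hia, Ne.symm hib]
  by_cases hid : i = d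
  · subst hid; simp [hia, hib, hic, Ne.symm hia, Ne.symm hib, Ne.symm hic]
  · simp [hia, hib, hic, hid, Ne.symm hia, Ne.symm hib, Ne.symm hic, Ne.symm hid]

/-- **`mem_I12_iff`**: `f ∈ I₁₂` iff every monomial of `f` has `(4,3,2,1)`-weight `≥ 12`.
[OURS · L1 W4.5c] -/
theorem mem_I12_iff (hab : a ≠ b) (hac : a ≠ c) (had : a ≠ d) (hbc : b ≠ c) (hbd : b ≠ d)
    (hcd : c ≠ d) (f : MvPolynomial (Fin n) k) :
    f ∈ I12 k n a b c d ↔ ∀ m, coeff m f ≠ 0 → 12 ≤ Finsupp.weight (weight n a b c d) m := by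
  classical
  constructor
  · intro hf
    change f ∈ Ideal.span (Set.range (gens12 k n a b c d)) at hf
    refine Submodule.span_induction ?_ ?_ ?_ ?_ hf
    · rintro _ ⟨j, rfl⟩ m hm
      rw [gens12_eq_monomial_finsupp, coeff_monomial] at hm
      split_ifs at hm with h
      · rw [← h, weight_eq n a b c d hab hac had hbc hbd hcd]
        simp only [exps_finsupp_apply n a b c d hab hac had hbc hbd hcd, Pi.single_apply]
        simp [hab.symm, hac.symm, had.symm, hbc.symm, hbd.symm, hcd.symm, hab, hac, had, hbc, hbd, hcd]
        exact twelve_le_weight_exps12 j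
      · exact absurd rfl hm
    · intro m hm
      simp at hm
    · intro f g _ _ hf hg
      exact JordanFour.lb_add (weight n a b c d) hf hg
    · intro r f _ hf
      have h := JordanFour.lb_mul (weight n a b c d) (u := 0) (v := 12) (f := r) (g := f)
        (fun d _ => Nat.zero_le _) hf
      simpa only [zero_add, smul_eq_mul] using h
  · intro hf
    rw [f.as_sum]
    refine Ideal.sum_mem _ fun m hm => ?_
    have hm' : coeff m f ≠ 0 := mem_support_iff.mp hm
    have hw := hf m hm'
    rw [weight_eq n a b c d hab hac had hbc hbd hcd] at hw
    obtain ⟨j, hja, hjb, hjc, hjd⟩ := exists_exps12_le (m a) (m b) (m c) (m d) hw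
    -- `monomial m (coeff m f) = C (coeff m f) * monomial (m - E_j) 1 * gens12 j`
    let E : Fin n →₀ ℕ := (exps12 j).1 • Finsupp.single a 1 + (exps12 j).2.1 • Finsupp.single b 1 +
      (exps12 j).2.2.1 • Finsupp.single c 1 + (exps12 j).2.2.2 • Finsupp.single d 1
    have hE : E ≤ m := by
      intro i
      rw [show E i = _ from exps_finsupp_apply n a b c d hab hac had hbc hbd hcd _ _ _ _ i]
      simp only [Pi.single_apply]
      by_cases hia : i = a
      · subst hia; simp [hab, hac, had]; exact hja
      by_cases hib : i = b
      · subst hib; simp [hia, hbc, hbd]; exact hjb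
      by_cases hic : i = c
      · subst hic; simp [hia, hib, hcd]; exact hjc
      by_cases hid : i = d
      · subst hid; simp [hia, hib, hic]; exact hjd
      · simp [hia, hib, hic, hid]
    have hsplit : monomial m (coeff m f) =
        monomial (m - E) (coeff m f) * gens12 k n a b c d j := by
      rw [gens12_eq_monomial_finsupp, monomial_mul, mul_one, tsub_add_cancel_of_le hE]
    rw [hsplit]
    exact Ideal.mul_mem_left _ _ (gens12_mem_I12 k n a b c d j)

/-! ## Weight-raising substitutions preserve `I₁₂` -/

/-- Lower weight bounds are stable under finite sums. [folklore] -/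
theorem lb_sum {R : Type*} [CommRing R] {τ : Type*} (w : τ → ℕ) {v : ℕ} {ι : Type*}
    (s : Finset ι) (f : ι → MvPolynomial τ R)
    (hf : ∀ i ∈ s, ∀ d, coeff d (f i) ≠ 0 → v ≤ Finsupp.weight w d) :
    ∀ d, coeff d (∑ i ∈ s, f i) ≠ 0 → v ≤ Finsupp.weight w d := by
  classical
  induction s using Finset.induction_on with
  | empty => intro d hd; simp at hd
  | insert i s hi ih =>
    rw [Finset.sum_insert hi]
    exact JordanFour.lb_add w (hf i (Finset.mem_insert_self i s))
      (ih fun i' hi' => hf i' (Finset.mem_insert_of_mem hi'))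

/-- Lower weight bounds of a finite product add up. [folklore] -/
theorem lb_finset_prod {R : Type*} [CommRing R] {τ : Type*} (w : τ → ℕ) {ι : Type*}
    (s : Finset ι) (f : ι → MvPolynomial τ R) (v : ι → ℕ)
    (hf : ∀ i ∈ s, ∀ d, coeff d (f i) ≠ 0 → v i ≤ Finsupp.weight w d) :
    ∀ d, coeff d (∏ i ∈ s, f i) ≠ 0 → ∑ i ∈ s, v i ≤ Finsupp.weight w d := by
  classical
  induction s using Finset.induction_on with
  | empty => intro d _; simp
  | insert i s hi ih =>
    rw [Finset.prod_insert hi, Finset.sum_insert hi]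
    exact JordanFour.lb_mul w (hf i (Finset.mem_insert_self i s))
      (ih fun i' hi' => hf i' (Finset.mem_insert_of_mem hi'))

/-- **A weight-raising `k`-algebra endomorphism preserves lower weight bounds**: if every monomial of
`φ x_i` has weight `≥ w i` for every variable, then every monomial of `φ f` has weight `≥ v`
whenever every monomial of `f` does. [folklore] -/
theorem lb_aeval_of_lb_X (w : Fin n → ℕ) (φ : MvPolynomial (Fin n) k →ₐ[k] MvPolynomial (Fin n) k)
    (hφ : ∀ i, ∀ d, coeff d (φ (X i)) ≠ 0 → w i ≤ Finsupp.weight w d)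
    {v : ℕ} {f : MvPolynomial (Fin n) k} (hf : ∀ d, coeff d f ≠ 0 → v ≤ Finsupp.weight w d) :
    ∀ d, coeff d (φ f) ≠ 0 → v ≤ Finsupp.weight w d := by
  classical
  rw [f.as_sum, map_sum]
  refine lb_sum w _ _ fun m hm => ?_
  have hvm : v ≤ Finsupp.weight w m := hf m (mem_support_iff.mp hm)
  rw [monomial_eq, map_mul, show φ (C (coeff m f)) = C (coeff m f) from φ.commutes (coeff m f),
    Finsupp.prod, map_prod]
  refine JordanFour.lb_C_mul w _ (JordanFour.lb_mono w hvm ?_)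
  have hprod := lb_finset_prod w m.support (fun i => φ (X i ^ m i)) (fun i => m i * w i)
    fun i _ => by
      rw [map_pow]
      exact JordanFour.lb_pow w (hφ i) (m i)
  have hwm : ∑ i ∈ m.support, m i * w i = Finsupp.weight w m := by
    rw [Finsupp.weight_apply, Finsupp.sum]
    rfl
  rw [hwm] at hprod
  exact hprod

/-- **`φ(I₁₂) ≤ I₁₂` for a weight-raising `k`-algebra endomorphism `φ`.** [OURS · L1 W4.5c] -/
theorem map_I12_le_of_lb_X (hab : a ≠ b) (hac : a ≠ c) (had : a ≠ d) (hbc : b ≠ c) (hbd : b ≠ d)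
    (hcd : c ≠ d) (φ : MvPolynomial (Fin n) k →ₐ[k] MvPolynomial (Fin n) k)
    (hφ : ∀ i, ∀ m, coeff m (φ (X i)) ≠ 0 → weight n a b c d i ≤ Finsupp.weight (weight n a b c d) m) :
    Ideal.map (φ : MvPolynomial (Fin n) k →+* MvPolynomial (Fin n) k) (I12 k n a b c d) ≤
      I12 k n a b c d := by
  rw [Ideal.map_le_iff_le_comap]
  intro f hf
  rw [Ideal.mem_comap, RingHom.coe_coe, mem_I12_iff k n a b c d hab hac had hbc hbd hcd]
  exact lb_aeval_of_lb_X k n (weight n a b c d) φ hφ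
    ((mem_I12_iff k n a b c d hab hac had hbc hbd hcd f).mp hf)

/-- The variables of the `J₅` datum are weight-raised by `σ`: a substitution
`x_i ↦ x_i + s₁ x_{i-1} + s₂ x_{i-2} + …` (lower indices are heavier) raises no weight. Here in the
concrete form used for `σ` and `σ⁻¹`: `φ x_a = x_a`, `φ x_b = x_b + s x_a`,
`φ x_c = x_c + s x_b + t x_a`, `φ x_d = x_d + s x_c + t x_b + u x_a`, and `φ x_i` for the other
`i` any polynomial at all (weight `0`). [OURS · L1 W4.5c] -/
theorem lb_X_of_law (hab : a ≠ b) (hac : a ≠ c) (had : a ≠ d) (hbc : b ≠ c) (hbd : b ≠ d)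
    (hcd : c ≠ d) (φ : MvPolynomial (Fin n) k →ₐ[k] MvPolynomial (Fin n) k) (s t u : k)
    (ha : φ (X a) = X a) (hb : φ (X b) = X b + C s * X a)
    (hc : φ (X c) = X c + C s * X b + C t * X a)
    (hd : φ (X d) = X d + C s * X c + C t * X b + C u * X a) :
    ∀ i, ∀ m, coeff m (φ (X i)) ≠ 0 → weight n a b c d i ≤ Finsupp.weight (weight n a b c d) m := by
  classical
  have hX : ∀ i : Fin n, ∀ m, coeff m (X i : MvPolynomial (Fin n) k) ≠ 0 →
      weight n a b c d i ≤ Finsupp.weight (weight n a b c d) m := by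
    intro i m hm
    rw [coeff_X] at hm
    split_ifs at hm with h
    · rw [← h, Finsupp.weight_single, smul_eq_mul, one_mul]
    · exact absurd rfl hm
  have hwa : weight n a b c d a = 4 := by simp [weight]
  have hwb : weight n a b c d b = 3 := by simp [weight, hab.symm]
  have hwc : weight n a b c d c = 2 := by simp [weight, hac.symm, hbc.symm]
  have hwd : weight n a b c d d = 1 := by simp [weight, had.symm, hbd.symm, hcd.symm]
  intro i
  by_cases hia : i = a
  · subst hia; rw [ha]; exact hX i
  by_cases hib : i = b
  · subst hib
    rw [hb, hwb]
    refine JordanFour.lb_add _ (by simpa [hwb] using hX i)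
      (JordanFour.lb_C_mul _ s (JordanFour.lb_mono _ (v := 4) (v' := 3) (by norm_num)
        (by simpa [hwa] using hX a)))
  by_cases hic : i = c
  · subst hic
    rw [hc, hwc]
    refine JordanFour.lb_add _ (JordanFour.lb_add _ (by simpa [hwc] using hX i)
      (JordanFour.lb_C_mul _ s (JordanFour.lb_mono _ (v := 3) (v' := 2) (by norm_num)
        (by simpa [hwb] using hX b))))
      (JordanFour.lb_C_mul _ t (JordanFour.lb_mono _ (v := 4) (v' := 2) (by norm_num)
        (by simpa [hwa] using hX a)))
  by_cases hid : i = d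
  · subst hid
    rw [hd, hwd]
    refine JordanFour.lb_add _ (JordanFour.lb_add _ (JordanFour.lb_add _ (by simpa [hwd] using hX i)
      (JordanFour.lb_C_mul _ s (JordanFour.lb_mono _ (v := 2) (v' := 1) (by norm_num)
        (by simpa [hwc] using hX c))))
      (JordanFour.lb_C_mul _ t (JordanFour.lb_mono _ (v := 3) (v' := 1) (by norm_num)
        (by simpa [hwb] using hX b))))
      (JordanFour.lb_C_mul _ u (JordanFour.lb_mono _ (v := 4) (v' := 1) (by norm_num)
        (by simpa [hwa] using hX a)))
  · intro m _
    have : weight n a b c d i = 0 := by simp [weight, hia, hib, hic, hid]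
    rw [this]; exact Nat.zero_le _

/-- **`σ(I₁₂) = I₁₂`** for the `J₅` datum (both `σ` and `σ⁻¹` are weight-raising substitutions of
the shape of `lb_X_of_law`: `(s,t,u) = (1,0,0)` and `(−1,1,−1)`). The law on `x_e` and the passengers
is not needed. [OURS · L1 W4.5c] -/
theorem map_I12_eq (hab : a ≠ b) (hac : a ≠ c) (had : a ≠ d) (hbc : b ≠ c) (hbd : b ≠ d)
    (hcd : c ≠ d) (σ : MvPolynomial (Fin n) k ≃ₐ[k] MvPolynomial (Fin n) k)
    (ha : σ (X a) = X a) (hb : σ (X b) = X b + X a) (hc : σ (X c) = X c + X b)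
    (hd : σ (X d) = X d + X c) :
    Ideal.map (σ : MvPolynomial (Fin n) k →+* MvPolynomial (Fin n) k) (I12 k n a b c d) =
      I12 k n a b c d := by
  apply le_antisymm
  · have h := map_I12_le_of_lb_X k n a b c d hab hac had hbc hbd hcd
      (σ : MvPolynomial (Fin n) k →ₐ[k] MvPolynomial (Fin n) k)
      (lb_X_of_law k n a b c d hab hac had hbc hbd hcd _ 1 0 0
        (by simpa using ha) (by simpa using hb) (by simpa using hc) (by simpa using hd))
    exact h
  · have ha' : σ.symm (X a) = X a := by
      conv_lhs => rw [← ha]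
      exact σ.symm_apply_apply _
    have hb' : σ.symm (X b) = X b + C (-1) * X a := by
      have h := σ.symm_apply_apply (X b)
      rw [hb, map_add, ha'] at h
      simp only [map_neg, map_one] at h ⊢
      linear_combination h
    have hc' : σ.symm (X c) = X c + C (-1) * X b + C 1 * X a := by
      have h := σ.symm_apply_apply (X c)
      rw [hc, map_add, hb'] at h
      simp only [map_neg, map_one] at h ⊢
      linear_combination h
    have hd' : σ.symm (X d) = X d + C (-1) * X c + C 1 * X b + C (-1) * X a := by
      have h := σ.symm_apply_apply (X d)
      rw [hd, map_add, hc'] at h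
      simp only [map_neg, map_one] at h ⊢
      linear_combination h
    have hle := map_I12_le_of_lb_X k n a b c d hab hac had hbc hbd hcd
      (σ.symm : MvPolynomial (Fin n) k →ₐ[k] MvPolynomial (Fin n) k)
      (lb_X_of_law k n a b c d hab hac had hbc hbd hcd _ (-1) 1 (-1)
        (by simpa using ha') (by simpa using hb') (by simpa using hc') (by simpa using hd'))
    have hcomp : (σ : MvPolynomial (Fin n) k →+* MvPolynomial (Fin n) k).comp
        (σ.symm : MvPolynomial (Fin n) k →+* MvPolynomial (Fin n) k) = RingHom.id _ := by
      ext x <;> simp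
    calc I12 k n a b c d
        = Ideal.map ((σ : MvPolynomial (Fin n) k →+* MvPolynomial (Fin n) k).comp
            (σ.symm : MvPolynomial (Fin n) k →+* MvPolynomial (Fin n) k)) (I12 k n a b c d) := by
          rw [hcomp, Ideal.map_id]
      _ = Ideal.map (σ : MvPolynomial (Fin n) k →+* MvPolynomial (Fin n) k)
            (Ideal.map (σ.symm : MvPolynomial (Fin n) k →+* MvPolynomial (Fin n) k)
              (I12 k n a b c d)) := by rw [Ideal.map_map]
      _ ≤ _ := Ideal.map_mono hle

/-- **`I₁₂` is `⟨σ⟩`-stable**: `g • I₁₂ = I₁₂` for every `g ∈ ⟨σ⟩`. [OURS · L1 W4.5c] -/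
theorem smul_I12_eq (hab : a ≠ b) (hac : a ≠ c) (had : a ≠ d) (hbc : b ≠ c) (hbd : b ≠ d)
    (hcd : c ≠ d) (σ : MvPolynomial (Fin n) k ≃ₐ[k] MvPolynomial (Fin n) k)
    (ha : σ (X a) = X a) (hb : σ (X b) = X b + X a) (hc : σ (X c) = X c + X b)
    (hd : σ (X d) = X d + X c) (g : Subgroup.zpowers σ) :
    g • I12 k n a b c d = I12 k n a b c d := by
  have hσ' : σ • I12 k n a b c d = I12 k n a b c d :=
    map_I12_eq k n a b c d hab hac had hbc hbd hcd σ ha hb hc hd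
  obtain ⟨z, hz⟩ := Subgroup.mem_zpowers_iff.mp g.2
  change (g : MvPolynomial (Fin n) k ≃ₐ[k] MvPolynomial (Fin n) k) • I12 k n a b c d = _
  rw [← hz]
  exact MulAction.fixedBy_subset_fixedBy_zpow (Ideal (MvPolynomial (Fin n) k)) σ z hσ'

/-- **The ideal sheaf of `I₁₂` on `𝔸ⁿ` is stable under every action of `⟨σ⟩` with the
affine-quotient law `ρ g = Spec (g⁻¹)`** — VERBATIM the hypothesis `hJ` of the RUNG V5 scaffold
`jordanFive_hasResolution_of_bricks` and of `IsBlowup.liftAction` for `Bl_{I₁₂} 𝔸ⁿ`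
(pattern `JordanFour.idealSheaf_I6_comap`, p490963). [OURS · L1 W4.5c] -/
theorem idealSheaf_I12_comap (hab : a ≠ b) (hac : a ≠ c) (had : a ≠ d) (hbc : b ≠ c)
    (hbd : b ≠ d) (hcd : c ≠ d) (σ : MvPolynomial (Fin n) k ≃ₐ[k] MvPolynomial (Fin n) k)
    (ha : σ (X a) = X a) (hb : σ (X b) = X b + X a) (hc : σ (X c) = X c + X b)
    (hd : σ (X d) = X d + X c)
    (ρ : ↥(Subgroup.zpowers σ) →* CategoryTheory.Aut (Spec (CommRingCat.of (MvPolynomial (Fin n) k))))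
    (hρ : ∀ g : ↥(Subgroup.zpowers σ), (ρ g).hom = Spec.map (CommRingCat.ofHom
      ((MulSemiringAction.toRingEquiv (↥(Subgroup.zpowers σ)) (MvPolynomial (Fin n) k) g⁻¹ :
        MvPolynomial (Fin n) k ≃+* MvPolynomial (Fin n) k) :
          MvPolynomial (Fin n) k →+* MvPolynomial (Fin n) k)))
    (g : ↥(Subgroup.zpowers σ)) :
    (affineBlowup.idealSheaf (I12 k n a b c d)).comap (ρ g).hom =
      affineBlowup.idealSheaf (I12 k n a b c d) :=
  AffineQuotient.idealSheaf_comap_specAction ρ hρ _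
    (smul_I12_eq k n a b c d hab hac had hbc hbd hcd σ ha hb hc hd) g

/-- **`Bl_{I₁₂} 𝔸ⁿ` is integral, and proper and birational over `𝔸ⁿ`** (`I₁₂ ∋ x_a³ ≠ 0`).
[OURS · L1 W4.5c] -/
theorem I12_blowup_integral_proper_birational :
    IsIntegral (affineBlowup (I12 k n a b c d)) ∧ IsProper (affineBlowup.π (I12 k n a b c d)) ∧
      IsBirational (affineBlowup.π (I12 k n a b c d)) := by
  have hne : I12 k n a b c d ≠ ⊥ := by
    intro h
    have h0 : gens12 k n a b c d 0 ∈ I12 k n a b c d := gens12_mem_I12 k n a b c d 0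
    rw [h, Ideal.mem_bot] at h0
    exact pow_ne_zero 3 (X_ne_zero a) h0
  exact ⟨affineBlowup.isIntegral hne, inferInstance, affineBlowup.isBirational hne⟩

end Summit.ResolutionOfSingularities.ResolutionOfSingularities.Theorems.WildQuotientResolution.JordanFive

end
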